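import Summits.ResolutionOfSingularities.ResolutionOfSingularities.Theorems.MarkedTransferCampaignW46ThreefoldsCurveSliceClosedPoints
import Summits.ResolutionOfSingularities.ResolutionOfSingularities.Theorems.MarkedTransferCampaignW46ThreefoldsTauTwoSliceFiniteType
import HarnessLib

/-!
# [OURS · L1 W4.6 rung (ii-τ2)] THE `τ ≥ 2` LOCUS SLICE WITH CLOSED-POINT HYPOTHESES — order-`μ` locus ⊆ a regular closed
# equimultiple curve (one or several disjoint components) with `τ ≥ 2` at its CLOSED points ∪ finitely many isolated `τ ≥ 2`
# threefold points: order-reducible, PROVED (quasi-compact `X`)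

Cell res-hironaka, LADDER-RESOLUTION rung L (D-0089), slot W4.6, rung (ii) (threefold hypersurfaces); seat res-L1-s46-pv-3
(gen 4). Host route MarkedTransfer, host item `HypersurfaceOrderReductionDimLeThree` (stmt-ResolutionOfSingularities-16156);
filed `--kind proof --supports` it `--as helper`. The locus slice p517124 with the curve piece in CLOSED-POINT form (p520244):
the hypotheses on the curve (codimension-`2` regular-parameter description, `τ ≥ 2`) are asked at CLOSED points only — the form
Cossart–Piltant actually use; the regular closed curve `Y` may have several (disjoint) components. This is the campaign's
recommended form of «the `τ ≥ 2` branch of Cossart–Piltant 2008 Prop. 4.4 with regular one-dimensional part». (On SINGULAR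
one-dimensional parts see p522422/p523611 and the caveat in their companion note: at a singular point of a curve component of the
top locus `τ ≤ 1` is forced, at least for `μ = 2` and in characteristic `0` or `p > μ`.) OURS scheme theory over PROVED tree
lemmas; nothing of H. Hironaka's manuscript is asserted. AI-written; AI review is weaker than expert review.

## What is proved (no definitions)

* `CampaignW46.orderReducible_of_two_le_tau_locus_closedPoints` — the locus slice, closed-point hypotheses, G-ring at the
  isolated points.
* `CampaignW46.orderReducible_of_two_le_tau_locus_closedPoints_of_locallyOfFiniteType` — finite type over a field: no G-ring
  hypothesis.
* `CampaignW46.gammaFreeGlobalDimLE_two_le_tau_locus_closedPoints_slice (p d)` — the binders of the Γ-free ladder.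

References: `…ThreefoldsTauTwoLocusSlice.lean` (p517124), `…ThreefoldsCurveSliceClosedPoints.lean` (p520244), `…ThreefoldsTauTwoSlice.lean`
(p515229), `…ThreefoldsTauTwoSliceFiniteType.lean` (p516287), `…GammaFreeGlobalPatchingFinite.lean` (p508549 [Piltant2013, Prop. 5.1]);
[CossartPiltant2008, Lemma 4.3, Prop. 4.4]. H. Hironaka, ms. 2017-03-23 — scope only, under adjudication, not cited as fact. [Hironaka2017]
-/

noncomputable section

set_option linter.dupNamespace false -- mandated namespace of this single-conjunct summit

open CategoryTheory AlgebraicGeometry TopologicalSpace IsLocalRing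

namespace Summit.ResolutionOfSingularities.ResolutionOfSingularities.Theorems

namespace CampaignW46

open Literature.AlgebraicGeometry.Resolution
open Scheme.IdealSheafData

universe u

variable {X : Scheme.{u}}

set_option maxHeartbeats 400000 in
-- the bookkeeping of `n + 1` patching pieces
/-- **THE `τ ≥ 2` LOCUS SLICE, CLOSED-POINT FORM.** `X` regular locally Noetherian and quasi-compact, `J`, `m ≥ 1`; the points
of order `≥ m` lie in `Y ∪ S` with `Y` a closed regular curve (possibly several disjoint components) carrying `ord = m` and, at
its CLOSED points, a codimension-`2` regular-parameter description with `τ ≥ 2`; `S` a finite set of closed points off `Y` with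
`ord = m`, embedding dimension `3`, `τ ≥ 2` and G-ring local rings. Then `(X, J, m)` is ORDER-REDUCIBLE.
[cite: CossartPiltant2008, Prop. 4.4 (proof); Piltant2013, Prop. 5.1] -/
theorem orderReducible_of_two_le_tau_locus_closedPoints [IsLocallyNoetherian X] [CompactSpace X] (hX : Scheme.IsRegular X)
    (J : X.IdealSheafData)
    {m : ℕ} (hm : 1 ≤ m) (Y : Closeds X) (hreg : Scheme.IsRegular (vanishingIdeal Y).subscheme)
    (hord : ∀ y ∈ (Y : Set X), idealOrder J y = m)
    (hcurve : ∀ y ∈ (Y : Set X), IsClosed ({y} : Set X) → haveI := hX y; ∃ c : Fin 2 → X.presheaf.stalk y,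
      IsRsopPart c ∧ Ideal.span (Set.range c) = stalkIdeal (vanishingIdeal Y) y ∧ 2 ≤ stalkTau J y m)
    (S : Set X) (hS : S.Finite) (hSc : ∀ x ∈ S, IsClosed ({x} : Set X)) (hSY : Disjoint S (Y : Set X))
    (hordS : ∀ x ∈ S, idealOrder J x = m) (hdim : ∀ x ∈ S, (maximalIdeal (X.presheaf.stalk x)).spanFinrank = 3)
    (hτ : ∀ x ∈ S, haveI := hX x; 2 ≤ stalkTau J x m) (hG : ∀ x ∈ S, IsGRing (X.presheaf.stalk x))
    (hJ : ∀ x : X, (m : ℕ∞) ≤ idealOrder J x → x ∈ (Y : Set X) ∨ x ∈ S) : OrderReducible J m := by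
  classical
  obtain ⟨n, f, hf⟩ := hS.fin_embedding
  have hfS : ∀ i, f i ∈ S := fun i => hf ▸ Set.mem_range_self i
  have hSf : ∀ x ∈ S, ∃ i, f i = x := fun x hx => by rw [← hf] at hx; exact hx
  -- the closed pieces
  have hScl : IsClosed S := isClosed_of_finite_of_isClosed_singleton hS hSc
  have hSicl : ∀ i, IsClosed (S \ {f i}) := fun i =>
    isClosed_of_finite_of_isClosed_singleton (hS.subset Set.sdiff_subset) fun y hy => hSc y hy.1
  let V : Fin (n + 1) → X.Opens := Fin.cases ⟨Sᶜ, hScl.isOpen_compl⟩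
    fun i => ⟨((Y : Set X) ∪ (S \ {f i}))ᶜ, (Y.2.union (hSicl i)).isOpen_compl⟩
  let Z : Fin (n + 1) → Set X := Fin.cases (Y : Set X) fun i => {f i}
  have hV0 : (V 0 : Set X) = Sᶜ := rfl
  have hVs : ∀ i : Fin n, (V i.succ : Set X) = ((Y : Set X) ∪ (S \ {f i}))ᶜ := fun i => rfl
  have hZ0 : Z 0 = (Y : Set X) := rfl
  have hZs : ∀ i : Fin n, Z i.succ = {f i} := fun i => rfl
  refine OrderReducible.of_opens_finite (n + 1) hX J m V Z (fun i => ?_) (fun i => ?_) (fun i j hij => ?_)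
    (fun x hx => ?_) (fun i => ?_)
  · -- closed pieces
    refine Fin.cases ?_ (fun i => ?_) i
    · rw [hZ0]; exact Y.2
    · rw [hZs]; exact hSc _ (hfS i)
  · -- `Z i ⊆ V i`
    refine Fin.cases ?_ (fun i => ?_) i
    · rw [hZ0, hV0]
      exact Set.subset_compl_iff_disjoint_left.mpr hSY
    · rw [hZs, hVs, Set.singleton_subset_iff, Set.mem_compl_iff, Set.mem_union, not_or]
      exact ⟨fun h => Set.disjoint_left.mp hSY (hfS i) h, fun h => h.2 rfl⟩
  · -- `Z i ∩ V j = ∅` for `i ≠ j`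
    revert hij
    refine Fin.cases ?_ (fun i' => ?_) i <;> refine Fin.cases ?_ (fun j' => ?_) j <;> intro hij
    · exact absurd rfl hij
    · rw [hZ0, hVs]
      exact Set.disjoint_left.mpr fun y hy hyV => hyV (Or.inl hy)
    · rw [hZs, hV0]
      exact Set.disjoint_left.mpr fun y hy hyV => hyV (by rw [Set.mem_singleton_iff.mp hy]; exact hfS i')
    · rw [hZs, hVs]
      refine Set.disjoint_left.mpr fun y hy hyV => hyV (Or.inr ⟨?_, ?_⟩)
      · rw [Set.mem_singleton_iff.mp hy]; exact hfS i'
      · rw [Set.mem_singleton_iff.mp hy, Set.mem_singleton_iff]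
        exact fun h => hij (by rw [f.injective h])
  · -- the pieces carry the order-`≥ m` locus
    rcases hJ x hx with h | h
    · exact ⟨0, by rw [hZ0]; exact h⟩
    · obtain ⟨i, rfl⟩ := hSf x h
      exact ⟨i.succ, by rw [hZs]; exact Set.mem_singleton _⟩
  · -- each piece is order-reducible
    refine Fin.cases ?_ (fun i => ?_) i
    · refine orderReducible_comap_of_curve_two_le_tau_closedPoints hX J hm (V 0) Y hreg (fun x hx => ?_) hord hcurve
      rcases hJ x hx with h | h
      · exact Or.inl h
      · exact Or.inr (by rw [hV0]; exact fun h' => h' h)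
    · refine orderReducible_comap_of_isolated_two_le_tau hX J hm (V i.succ) (f i) ?_ (hSc _ (hfS i)) (fun z hz => ?_)
        (hordS _ (hfS i)) (hdim _ (hfS i)) (hτ _ (hfS i)) (hG _ (hfS i))
      · change f i ∈ (V i.succ : Set X)
        rw [hVs, Set.mem_compl_iff, Set.mem_union, not_or]
        exact ⟨fun h => Set.disjoint_left.mp hSY (hfS i) h, fun h => h.2 rfl⟩
      · by_cases hzi : z = f i
        · exact Or.inl hzi
        · right
          rw [hVs, Set.mem_compl_iff, not_not]
          rcases hJ z hz with h | h
          · exact Or.inl h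
          · exact Or.inr ⟨h, hzi⟩

/-- The closed-point locus slice for `X` regular and of finite type over a field: NO G-ring hypothesis.
[cite: CossartPiltant2008, Prop. 4.4; Matsumura1987, §32] -/
theorem orderReducible_of_two_le_tau_locus_closedPoints_of_locallyOfFiniteType {k : Type u} [Field k]
    (s : X ⟶ Spec (.of k)) [LocallyOfFiniteType s] [QuasiCompact s] (hX : Scheme.IsRegular X) (J : X.IdealSheafData)
    {m : ℕ} (hm : 1 ≤ m) (Y : Closeds X) (hreg : Scheme.IsRegular (vanishingIdeal Y).subscheme)
    (hord : ∀ y ∈ (Y : Set X), idealOrder J y = m)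
    (hcurve : ∀ y ∈ (Y : Set X), IsClosed ({y} : Set X) → haveI := hX y; ∃ c : Fin 2 → X.presheaf.stalk y,
      IsRsopPart c ∧ Ideal.span (Set.range c) = stalkIdeal (vanishingIdeal Y) y ∧ 2 ≤ stalkTau J y m)
    (S : Set X) (hS : S.Finite) (hSc : ∀ x ∈ S, IsClosed ({x} : Set X)) (hSY : Disjoint S (Y : Set X))
    (hordS : ∀ x ∈ S, idealOrder J x = m) (hdim : ∀ x ∈ S, (maximalIdeal (X.presheaf.stalk x)).spanFinrank = 3)
    (hτ : ∀ x ∈ S, haveI := hX x; 2 ≤ stalkTau J x m)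
    (hJ : ∀ x : X, (m : ℕ∞) ≤ idealOrder J x → x ∈ (Y : Set X) ∨ x ∈ S) : OrderReducible J m := by
  haveI : IsLocallyNoetherian X := LocallyOfFiniteType.isLocallyNoetherian s
  haveI : CompactSpace X := QuasiCompact.compactSpace_of_compactSpace s
  exact orderReducible_of_two_le_tau_locus_closedPoints hX J hm Y hreg hord hcurve S hS hSc hSY hordS hdim hτ
    (fun x _ => isGRing_stalk_of_polynomial Matsumura1987_32_polynomial_holds s x) hJ

/-- **THE CLOSED-POINT `τ ≥ 2` LOCUS SLICE OF EVERY RUNG OF THE Γ-FREE LADDER** (`GammaFreeGlobalOrderReductionDimLE p d`,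
p496755), unconditionally. [cite: CossartPiltant2008, Prop. 4.4; Matsumura1987, §32] -/
theorem gammaFreeGlobalDimLE_two_le_tau_locus_closedPoints_slice (p d : ℕ) :
    p.Prime → ∀ (k : Type u) [Field k] [CharP k p] [PerfectField k] (X : Scheme.{u}) (s : X ⟶ Spec (.of k)),
      IsSeparated s → LocallyOfFiniteType s → QuasiCompact s → IsIntegral X → ∀ (hreg : Scheme.IsRegular X),
        topologicalKrullDim X ≤ d → ∀ (I : X.IdealSheafData), I ≠ ⊥ → IsEffectiveCartier I → ∀ (m : ℕ), 1 ≤ m →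
          ∀ (Y : Closeds X), Scheme.IsRegular (vanishingIdeal Y).subscheme → (∀ y ∈ (Y : Set X), idealOrder I y = m) →
            (∀ y ∈ (Y : Set X), IsClosed ({y} : Set X) → haveI := hreg y; ∃ c : Fin 2 → X.presheaf.stalk y,
              IsRsopPart c ∧ Ideal.span (Set.range c) = stalkIdeal (vanishingIdeal Y) y ∧ 2 ≤ stalkTau I y m) →
            ∀ (S : Set X), S.Finite → (∀ x ∈ S, IsClosed ({x} : Set X)) → Disjoint S (Y : Set X) →
              (∀ x ∈ S, idealOrder I x = m) → (∀ x ∈ S, (maximalIdeal (X.presheaf.stalk x)).spanFinrank = 3) →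
                (∀ x ∈ S, haveI := hreg x; 2 ≤ stalkTau I x m) →
                  (∀ x : X, (m : ℕ∞) ≤ idealOrder I x → x ∈ (Y : Set X) ∨ x ∈ S) → OrderReducible I m := by
  intro _ k _ _ _ X s _ hloft hqc _ hreg _ I _ _ m hm Y hYreg hord hcurve S hS hSc hSY hordS hdim hτ hJ
  exact orderReducible_of_two_le_tau_locus_closedPoints_of_locallyOfFiniteType s hreg I hm Y hYreg hord hcurve S hS hSc hSY
    hordS hdim hτ hJ

end CampaignW46

end Summit.ResolutionOfSingularities.ResolutionOfSingularities.Theorems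

end
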